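import Literature.Probability.RandomPlanarGeometry.HexSAWStripBetaLengthWidthTwoLaw
import Literature.Probability.RandomPlanarGeometry.HexSAWStripSurfaceWidthOneThreshold
import HarnessLib

/-!
# The β-walks of the width-ONE strip by length, exactly: `bℓ_1(2k)(y) = 2 x_c^{2k} y^k`, so `bℓ_1(2k)(y_1) = 2` — the length amplitude
# `Λℓ_T > 0` exists for EVERY width `T ≥ 1`, with `Λℓ_1 = 2`, `Λℓ_2 = (19 − 6√2)/8` (module «BETA-LENGTH-WIDTH-ONE»)

Topic `Literature/Probability/RandomPlanarGeometry` (continues «BETA-LENGTH-WIDTH-TWO-LAW» `HexSAWStripBetaLengthWidthTwoLaw.lean` —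
`HV.sum_betaMidWalks_eq_sum_bridgeLists` (β mid-walks ↔ `bridgeLists` for any weight), `HV.tendsto_betaLenSum_two_even` (`Λℓ_2 = (19 − 6√2)/8`);
«BETA-LENGTH-LAW» #586 `HV.exists_pos_tendsto_betaLenSum_even` (`T ≥ 2`); «BETA-LENGTH-SPLIT» #578 `HV.betaLenSum`, `HV.betaLen`; the width-one files
`HexSAWStripWidthOne.lean` (`filter_isBetaDart_one_eq_image`: the β-walks of `S_{1,L}` are the two zig-zags `zigWalk s k`, `s = ±1`, `1 ≤ k ≤ L+1`;
`zigWalk_injOn`, `mwLen_zigWalk = 2k`), `HexSAWStripSurfaceWidthOne.lean` (`surfContacts_one_zigWalk = k`, `HV.stripYT_one = 2 + √2`),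
`HexSAWStripSurfaceWidthOneThreshold.lean` (`HV.hexCriticalFugacity_sq_mul_stripYT_one : x_c² y_1 = 1`)).  Lane «pcv-sawmu», a-p2 g22 — car 5 of the
«β-walks by length» programme.  Sources of the SETTING: N. R. Beaton et al., CMP 326 (2014) proof of Proposition 5 (arXiv v5 p. 9: the zig-zag walks
sticking to the surface), §3.2, Corollary 8 (`y_T`); H. Duminil-Copin, S. Smirnov, Ann. Math. 175 (2012) §3.  The contact-graded twin is the tree's
`HV.stripBcoeff_one_eq` (`β_{1,m} = 2x_c^{2m}`, «BETA-COEFF-ALL-T» #510); here the SAME two walks are read off by length.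

## What is proved (namespace `Literature.Probability.RandomPlanarGeometry.SAW.HV`)

* `sum_bridgeLists_one_eq` — `Σ_{β-walks of S_{1,L}} φ(|ω|, c(ω)) = Σ_{s = ±1} Σ_{k=1}^{L+1} φ(2k, k)` for any weight `φ`;
* ★ `betaLenSum_one_two_mul` — `bℓ_1(2k)(y) = 2 x_c^{2k} y^k` (`k ≥ 1`), `betaLenSum_one_zero`, and (odd lengths) `betaLenSum_one_odd`;
* ★ `betaLenSum_one_two_mul_stripYT` — `bℓ_1(2k)(y_1) = 2` for `k ≥ 1` (`x_c² y_1 = 1`); ★ `tendsto_betaLenSum_one_even` (`→ 2`);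
* ★★ `exists_pos_tendsto_betaLenSum_even_of_one_le` — for EVERY `T ≥ 1` there is `Λℓ_T > 0` with `bℓ_T(2m)(y_T) → Λℓ_T` and no odd lengths
  (width one explicit, `T ≥ 2` from #586); `Λℓ_1 = 2 = Λ_1` while `Λℓ_2 = (19 − 6√2)/8 ≠ Λ_2 = (45 + √2)/28` (`lengthAmplitude_two_ne_contactAmplitude_two`):
  the length and the contact amplitudes agree only in the trivial width.

Label: LANE LEMMA/COROLLARY (own, a-p2 g22, 2026-08-26).  NOT claimed: widths `T ≥ 3` in closed form, uniformity in `T`.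
-/

noncomputable section

open Finset Filter Topology Literature.Probability.LatticeModels Literature.Probability.Percolation

namespace Literature.Probability.RandomPlanarGeometry.SAW.HV

/-- `Σ_{β-walks of S_{1,L}} φ(|ω|, c(ω)) = Σ_{s ∈ {1,−1}} Σ_{k=1}^{L+1} φ(2k, k)`: the β-walks of the width-one strip are the two zig-zags of each
even length, the one with `2k` vertices having `k` surface contacts. [cite: BeatonBousquetMelouDeGierDuminilCopinGuttmann2014, proof of Proposition 5 (arXiv v5 p. 9); DuminilCopinSmirnov2012, §3; lane: exact width-one count by length] -/
theorem sum_bridgeLists_one_eq (φ : ℕ → ℕ → ℝ) (L : ℕ) :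
    ∑ l ∈ bridgeLists 1 L, φ l.length (topCnt 1 l) = ∑ _s ∈ ({1, -1} : Finset ℤ), ∑ k ∈ Icc 1 (L + 1), φ (2 * k) k := by
  rw [← sum_betaMidWalks_eq_sum_bridgeLists le_rfl φ L, filter_isBetaDart_one_eq_image, sum_image (zigWalk_injOn L), sum_product]
  refine sum_congr rfl fun s hs => sum_congr rfl fun k _ => ?_
  have hs' : s = 1 ∨ s = -1 := by simpa using hs
  rw [mwLen_zigWalk, surfContacts_one_zigWalk hs']

/-- ★ **`bℓ_1(2k)(y) = 2 x_c^{2k} y^k` for `k ≥ 1`**: exactly two β-walks of `S_1` with `2k` vertices (the left and the right zig-zag), each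
with `k` contacts. [cite: BeatonBousquetMelouDeGierDuminilCopinGuttmann2014, proof of Proposition 5 (arXiv v5 p. 9) and §3.2; lane «pcv-sawmu» a-p2 g22 — own] -/
theorem betaLenSum_one_two_mul {k : ℕ} (hk : 1 ≤ k) (y : ℝ) :
    betaLenSum 1 (2 * k) y = 2 * hexCriticalFugacity ^ (2 * k) * y ^ k := by
  classical
  have h1 : betaLenSum 1 (2 * k) y =
      ∑ l ∈ bridgeLists 1 (2 * k), (if l.length = 2 * k then hexCriticalFugacity ^ l.length * y ^ topCnt 1 l else 0) := by
    rw [betaLenSum, betaLen, sum_filter]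
  rw [h1, sum_bridgeLists_one_eq (fun a b => if a = 2 * k then hexCriticalFugacity ^ a * y ^ b else 0)]
  have hinner : ∑ j ∈ Icc 1 (2 * k + 1), (if 2 * j = 2 * k then hexCriticalFugacity ^ (2 * j) * y ^ j else 0) =
      hexCriticalFugacity ^ (2 * k) * y ^ k := by
    rw [Finset.sum_eq_single_of_mem k (mem_Icc.2 ⟨hk, by omega⟩) (fun j _ hj => if_neg (by omega)), if_pos rfl]
  rw [sum_congr rfl fun _ _ => hinner, sum_pair (by norm_num : (1 : ℤ) ≠ -1)]
  ring

/-- Odd lengths and length `0` carry no β-walk of `S_1`. [cite: DuminilCopinSmirnov2012, §3; lane plumbing] -/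
theorem betaLenSum_one_odd (m : ℕ) (y : ℝ) : betaLenSum 1 (2 * m + 1) y = 0 ∧ betaLenSum 1 0 y = 0 := by
  classical
  constructor
  · exact betaLenSum_eq_zero_of_odd le_rfl (Nat.not_even_iff_odd.2 ⟨m, rfl⟩) y
  · have h1 : betaLenSum 1 0 y =
        ∑ l ∈ bridgeLists 1 0, (if l.length = 0 then hexCriticalFugacity ^ l.length * y ^ topCnt 1 l else 0) := by
      rw [betaLenSum, betaLen, sum_filter]
    rw [h1, sum_bridgeLists_one_eq (fun a b => if a = 0 then hexCriticalFugacity ^ a * y ^ b else 0)]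
    refine sum_eq_zero fun s _ => sum_eq_zero fun j hj => ?_
    rw [mem_Icc] at hj
    exact if_neg (by omega)

/-- ★ **`bℓ_1(2k)(y_1) = 2` for `k ≥ 1`** (`y_1 = 2 + √2 = x_c^{−2}`): at its threshold every even length carries EXACTLY mass `2`.
[cite: BeatonBousquetMelouDeGierDuminilCopinGuttmann2014, Corollary 8 (arXiv v5 p. 12: y_T); lane «pcv-sawmu» a-p2 g22 — own] -/
theorem betaLenSum_one_two_mul_stripYT {k : ℕ} (hk : 1 ≤ k) : betaLenSum 1 (2 * k) (stripYT 1) = 2 := by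
  rw [betaLenSum_one_two_mul hk, pow_mul, mul_assoc, ← mul_pow, hexCriticalFugacity_sq_mul_stripYT_one, one_pow, mul_one]

/-- ★ `bℓ_1(2m)(y_1) → Λℓ_1 = 2`. [cite: BeatonBousquetMelouDeGierDuminilCopinGuttmann2014, Corollary 8; lane «pcv-sawmu» a-p2 g22 — own] -/
theorem tendsto_betaLenSum_one_even : Tendsto (fun m : ℕ => betaLenSum 1 (2 * m) (stripYT 1)) atTop (𝓝 2) :=
  tendsto_const_nhds.congr' ((eventually_ge_atTop 1).mono fun _ hm => (betaLenSum_one_two_mul_stripYT hm).symm)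

/-- ★★ **The length amplitude exists for EVERY width `T ≥ 1`**: `∃ Λℓ_T > 0`, `bℓ_T(2m)(y_T) → Λℓ_T` and `bℓ_T(2m+1)(y_T) = 0`
(width one explicit with `Λℓ_1 = 2`; `T ≥ 2` is #586 `HV.exists_pos_tendsto_betaLenSum_even`).
[cite: BeatonBousquetMelouDeGierDuminilCopinGuttmann2014, §3.2 and Corollary 8; Feller1968, XIII.3; lane «pcv-sawmu» a-p2 g22 — own result] -/
theorem exists_pos_tendsto_betaLenSum_even_of_one_le {T : ℕ} (hT : 1 ≤ T) :
    ∃ Λ : ℝ, 0 < Λ ∧ Tendsto (fun m : ℕ => betaLenSum T (2 * m) (stripYT T)) atTop (𝓝 Λ) ∧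
      ∀ m : ℕ, betaLenSum T (2 * m + 1) (stripYT T) = 0 := by
  rcases Nat.lt_or_ge T 2 with h | h
  · obtain rfl : T = 1 := by omega
    exact ⟨2, two_pos, tendsto_betaLenSum_one_even, fun m => (betaLenSum_one_odd m _).1⟩
  · exact exists_pos_tendsto_betaLenSum_even h

/-- The table so far: `Λℓ_1 = 2 = Λ_1` (`HV.tendsto_stripBcoeff_one_mul_pow`), but `Λℓ_2 = (19 − 6√2)/8 ≠ (45 + √2)/28 = Λ_2` — the length and
the contact amplitudes coincide only in the trivial width. [cite: BeatonBousquetMelouDeGierDuminilCopinGuttmann2014, Corollary 8; lane «pcv-sawmu» a-p2 g21/g22 — own] -/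
theorem lengthAmplitude_two_ne_contactAmplitude_two : (19 - 6 * Real.sqrt 2) / 8 ≠ (45 + Real.sqrt 2) / 28 := by
  intro h
  have hr : Real.sqrt 2 ^ 2 = 2 := Real.sq_sqrt (by norm_num)
  have h44 : Real.sqrt 2 = 43 / 44 := by linarith
  rw [h44] at hr
  norm_num at hr

end Literature.Probability.RandomPlanarGeometry.SAW.HV
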